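import Mathlib
import HarnessLib
import Summits.HubbardSuperconductivity.HubbardSuperconductivity.Theorems.WeakCouplingBCSWcbcsKohnLuttingerB1gFormAWindowD005D025
import Summits.HubbardSuperconductivity.HubbardSuperconductivity.Theorems.WeakCouplingBCSKlCertB1gWindowD005D030
import Summits.HubbardSuperconductivity.HubbardSuperconductivity.Theorems.KLProgrammeMuOfDopingWindowFillingD030Upper

/-!
# Route `WeakCouplingBCS` — support item `WcbcsKohnLuttingerB1g` (stmt-HubbardSuperconductivity-0158):
# the R2d certificate half in FORM (A) on the doping windows `δ ∈ [0.05, 0.30]` and `δ ∈ [0.10, 0.30]`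

Seat cert-2's generation-2 window records `klCertB1gWinX` (16 half-width μ-uniform boxes on `μ ∈ [-0.7275, -0.6875]`,
margin `γ_X = 22025/1048576`) and `klCertB1gWinY` (31 boxes on `[-0.6875, -0.5725]`, `γ_Y = 14349/1048576`) extend the certified
chemical-potential window of the `B1g` Kohn–Luttinger certificate to `μ ∈ [-0.7275, -0.075]` (148 boxes, seven records; the
μ-level glue is `klb1g_window_d005_d030`, `Theorems/WeakCouplingBCSKlCertB1gWindowD005D030.lean`).  This file reads the seven
(resp. six) records — in form (A), i.e. modulo the named enclosure hypotheses `klCertB1gWin{X,Y,Z,A,B,C,D}.EnclosuresB1g` — in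
the DOPING variable:

* `muOfDoping_mem_window_d005_d030`, `muOfDoping_mem_window_d010_d030` — UNCONDITIONALLY `μ(δ) ∈ [-0.7275, -0.075]` for
  `δ ∈ [0.05, 0.30]` and `μ(δ) ∈ [-0.7275, -0.1775]` for `δ ∈ [0.10, 0.30]`, from the certified fillings `n(-0.7275) < 7/10`
  (`muWinD030_filling_lt`, circumscribed tangent polygon, `Theorems/KLProgrammeMuOfDopingWindowFillingD030Upper.lean`),
  `n(-0.075) ≥ 19/20` (`klfillL005_filling_ge`), `n(-0.1775) ≥ 9/10` (`klfillL010_filling_ge`), and `chemicalPotentialOfDensity_window`;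
* `klCertB1gWinX_b1g_le`, `klCertB1gWinY_b1g_le` (`decide +kernel`: every box has `B1g` Ritz `rhohi ≤ -1/16`; the weakest is
  `-0.0658` at the `δ ≈ 0.30` end) and `klb1g_formA_b1g_le_window_d025_d030` (`channelInf ε₀ μ 1 B1g ≤ -1/16` on `[-0.7275, -0.5725]`);
* `klb1g_window_d005_d030_const`, `klb1g_window_d010_d030_const` — the μ-level selection statements with the NUMERIC margin
  `14349/1048576 = γ_Y` (the smallest of the seven record margins, `klb1g_window_d005_d030_gamma_eq`), the second WITHOUT the
  `WinD` hypothesis (window `[-0.7275, -0.1775]`, records `X, Y, Z, A, B, C`);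
* `klb1g_formA_r2d_certificate_d005_d030` (seven records) and `klb1g_formA_r2d_certificate_d010_d030` (six records) — for every
  `δ` of the window: (i) SELECTION for every `0 < U < 1`, `χ ≠ B1g`:
  `channelInf ε₀ μ(δ) U B1g + (14349/1048576) U² ≤ channelInf ε₀ μ(δ) U χ`; (ii) ATTRACTION for every `U`:
  `channelInf ε₀ μ(δ) U B1g ≤ -(1/16) U²`; and the `klCoefficient` corollaries (`≥ 1/16`).
  (On the sub-windows the sharper constants of `…FormAWindow.lean` (`437/16384`, `1/8` on `[0.10, 0.20]`),
  `…FormAWindowD010D025.lean` (`16905/1048576`, `1/12` on `[0.10, 0.25]`) and `…FormAWindowD005D025.lean` stand.)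

Folklore glue; no definitions.  Write-up of the numerics: cell `gate-hubbard-kl`, HOME/hubbard-kl-cert-2/MU-WINDOW-3.md.
-/

noncomputable section

-- the tree's namespace `Summit.<Summit>.<Problem>.Theorems` repeats the summit name by design (D-0017)
set_option linter.dupNamespace false

namespace Summit.HubbardSuperconductivity.HubbardSuperconductivity.Theorems

open MeasureTheory Literature.MathematicalPhysics.QuantumLattice CwKLChiralWindow
open Summit.HubbardSuperconductivity.HubbardSuperconductivity.Theses.WeakCouplingBCS

/-! ### The doping windows sit inside the certified chemical-potential windows (unconditional) -/

/-- **`μ(δ) ∈ [-0.7275, -0.075]` for every hole doping `δ ∈ [0.05, 0.30]`** (unconditional): the certified fillings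
`n(-0.7275) < 7/10` and `n(-0.075) ≥ 19/20` put `[0.05, 0.30]` inside `[1 - n(-0.075), 1 - n(-0.7275)]`, where `δ ↦ μ(δ)`
inverts the strictly increasing filling (`chemicalPotentialOfDensity_window`). [folklore] -/
theorem muOfDoping_mem_window_d005_d030 :
    ∀ δ ∈ Set.Icc (0.05 : ℝ) 0.30,
      chemicalPotentialOfDensity (squareDispersion 1 0) (1 - δ) ∈ Set.Icc (-0.7275 : ℝ) (-0.075) := by
  obtain ⟨-, -, -, H⟩ := chemicalPotentialOfDensity_window (μ₁ := (-0.075 : ℝ)) (μ₂ := (-0.7275 : ℝ))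
    (by norm_num) (by norm_num) (by norm_num)
  have hlo := klfillL005_filling_ge
  have hhi := muWinD030_filling_lt
  rw [show (-(3 / 40) : ℝ) = -0.075 by norm_num] at hlo
  rw [show (-(291 : ℝ) / 400) = -0.7275 by norm_num] at hhi
  intro δ hδ
  refine H δ ⟨?_, ?_⟩
  · norm_num at hδ hlo ⊢; linarith [hδ.1]
  · norm_num at hδ hhi ⊢; linarith [hδ.2]

/-- **`μ(δ) ∈ [-0.7275, -0.1775]` for every hole doping `δ ∈ [0.10, 0.30]`** (unconditional; certified fillings
`n(-0.7275) < 7/10`, `n(-0.1775) ≥ 9/10`, `chemicalPotentialOfDensity_window`). [folklore] -/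
theorem muOfDoping_mem_window_d010_d030 :
    ∀ δ ∈ Set.Icc (0.10 : ℝ) 0.30,
      chemicalPotentialOfDensity (squareDispersion 1 0) (1 - δ) ∈ Set.Icc (-0.7275 : ℝ) (-0.1775) := by
  obtain ⟨-, -, -, H⟩ := chemicalPotentialOfDensity_window (μ₁ := (-0.1775 : ℝ)) (μ₂ := (-0.7275 : ℝ))
    (by norm_num) (by norm_num) (by norm_num)
  have hlo := klfillL010_filling_ge
  have hhi := muWinD030_filling_lt
  rw [show (-(71 / 400) : ℝ) = -0.1775 by norm_num] at hlo
  rw [show (-(291 : ℝ) / 400) = -0.7275 by norm_num] at hhi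
  intro δ hδ
  refine H δ ⟨?_, ?_⟩
  · norm_num at hδ hlo ⊢; linarith [hδ.1]
  · norm_num at hδ hhi ⊢; linarith [hδ.2]

/-! ### Certified attraction on the new records `WinX`, `WinY` -/

/-- Every box of `klCertB1gWinX` has `B1g` Ritz upper bound `rhohi ≤ -1/16` (kernel decision; max `-0.0658`). [folklore] -/
theorem klCertB1gWinX_b1g_le : (klCertB1gWinX.boxes.all fun bx => decide (bx.bB1g.rhohi ≤ -(1 / 16))) = true := by
  decide +kernel

/-- Every box of `klCertB1gWinY` has `B1g` Ritz upper bound `rhohi ≤ -1/16` (kernel decision; max `-0.0724`). [folklore] -/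
theorem klCertB1gWinY_b1g_le : (klCertB1gWinY.boxes.all fun bx => decide (bx.bB1g.rhohi ≤ -(1 / 16))) = true := by
  decide +kernel

/-- **Certified attraction on `μ ∈ [-0.7275, -0.5725]`** (the `WinX ∪ WinY` window, `δ ≈ 0.25–0.30`), modulo their enclosures:
`channelInf ε₀ μ 1 B1g ≤ -1/16`. [cite: RaghuKivelsonScalapino2010, §III Fig. 2] -/
theorem klb1g_formA_b1g_le_window_d025_d030 (hX : klCertB1gWinX.EnclosuresB1g) (hY : klCertB1gWinY.EnclosuresB1g) :
    ∀ μ ∈ Set.Icc (-0.7275 : ℝ) (-0.5725), channelInf (squareDispersion 1 0) μ 1 D4Irrep.B1g ≤ -(1 / 16 : ℝ) := by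
  have wX := klb1gd_window_b1g_le klCertB1gWinX klCertB1gWinX_check hX (1 / 16) klCertB1gWinX_b1g_le
  have wY := klb1gd_window_b1g_le klCertB1gWinY klCertB1gWinY_check hY (1 / 16) klCertB1gWinY_b1g_le
  have x1 : (((klCertB1gWinX).mub : ℚ) : ℝ) = -0.7275 := by
    show (((-291 : ℚ) / 400 : ℚ) : ℝ) = -0.7275
    push_cast; norm_num
  have x2 : (((klCertB1gWinX).mua : ℚ) : ℝ) = -0.6875 := by
    show (((-11 : ℚ) / 16 : ℚ) : ℝ) = -0.6875
    push_cast; norm_num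
  have y1 : (((klCertB1gWinY).mub : ℚ) : ℝ) = -0.6875 := by
    show (((-11 : ℚ) / 16 : ℚ) : ℝ) = -0.6875
    push_cast; norm_num
  have y2 : (((klCertB1gWinY).mua : ℚ) : ℝ) = -0.5725 := by
    show (((-229 : ℚ) / 400 : ℚ) : ℝ) = -0.5725
    push_cast; norm_num
  have ea : (((1 / 16 : ℚ) : ℚ) : ℝ) = (1 / 16 : ℝ) := by push_cast; norm_num
  rw [x1, x2, ea] at wX
  rw [y1, y2, ea] at wY
  intro μ hμ
  by_cases hcut : μ ≤ -0.6875
  · exact wX μ ⟨hμ.1, hcut⟩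
  · exact wY μ ⟨by linarith, hμ.2⟩

/-! ### Selection at the μ level with the numeric margin `γ_Y = 14349/1048576` -/

/-- **`B1g` dominance on `μ ∈ [-0.7275, -0.075]` with the numeric margin `14349/1048576`** (`= min` of the seven record margins,
`klb1g_window_d005_d030_gamma_eq`), modulo the seven enclosure hypotheses. [cite: RaghuKivelsonScalapino2010, §III Fig. 2] -/
theorem klb1g_window_d005_d030_const (hX : klCertB1gWinX.EnclosuresB1g) (hY : klCertB1gWinY.EnclosuresB1g)
    (hZ : klCertB1gWinZ.EnclosuresB1g) (hA : klCertB1gWinA.EnclosuresB1g) (hB : klCertB1gWinB.EnclosuresB1g)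
    (hC : klCertB1gWinC.EnclosuresB1g) (hD : klCertB1gWinD.EnclosuresB1g) :
    ∀ μ ∈ Set.Icc (-0.7275 : ℝ) (-0.075), ∀ U ∈ Set.Ioo (0 : ℝ) 1, ∀ χ : D4Irrep, χ ≠ D4Irrep.B1g →
      channelInf (squareDispersion 1 0) μ U D4Irrep.B1g + (14349 / 1048576 : ℝ) * U ^ 2 ≤
        channelInf (squareDispersion 1 0) μ U χ := by
  have h := klb1g_window_d005_d030 hX hY hZ hA hB hC hD
  have hγ : min ((klCertB1gWinX.gamma : ℚ) : ℝ)
      (min ((klCertB1gWinY.gamma : ℚ) : ℝ)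
        (min (min ((klCertB1gWinZ.gamma : ℚ) : ℝ)
          (min (min ((klCertB1gWinA.gamma : ℚ) : ℝ) ((klCertB1gWinB.gamma : ℚ) : ℝ)) ((klCertB1gWinC.gamma : ℚ) : ℝ)))
          ((klCertB1gWinD.gamma : ℚ) : ℝ))) = (14349 / 1048576 : ℝ) := by
    have hq := congrArg (fun q : ℚ => (q : ℝ)) klb1g_window_d005_d030_gamma_eq
    push_cast at hq
    exact hq
  rw [hγ] at h
  exact h

/-- **`B1g` dominance on `μ ∈ [-0.7275, -0.1775]` (⊃ `μ([0.10, 0.30])`) with the numeric margin `14349/1048576`, modulo the SIX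
enclosure hypotheses `X, Y, Z, A, B, C`** (no `WinD`): union of `WinX`, `WinY` (margins `γ_X ≥ γ_Y = 14349/1048576`), `WinZ`
(`γ_Z = 16905/1048576`) and the window of record `klb1g_window_d010_d020` (`min γ_A γ_B γ_C = 437/16384`).
[cite: RaghuKivelsonScalapino2010, §III Fig. 2] -/
theorem klb1g_window_d010_d030_const (hX : klCertB1gWinX.EnclosuresB1g) (hY : klCertB1gWinY.EnclosuresB1g)
    (hZ : klCertB1gWinZ.EnclosuresB1g) (hA : klCertB1gWinA.EnclosuresB1g) (hB : klCertB1gWinB.EnclosuresB1g)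
    (hC : klCertB1gWinC.EnclosuresB1g) :
    ∀ μ ∈ Set.Icc (-0.7275 : ℝ) (-0.1775), ∀ U ∈ Set.Ioo (0 : ℝ) 1, ∀ χ : D4Irrep, χ ≠ D4Irrep.B1g →
      channelInf (squareDispersion 1 0) μ U D4Irrep.B1g + (14349 / 1048576 : ℝ) * U ^ 2 ≤
        channelInf (squareDispersion 1 0) μ U χ := by
  -- the four μ-uniform statements with explicit window ends
  have wX := klCertB1gWinX_window_U hX
  have wY := klCertB1gWinY_window_U hY
  have wZ := klCertB1gWinZ_window_U hZ
  have wABC := klb1g_window_d010_d020 hA hB hC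
  have x1 : (((klCertB1gWinX).mub : ℚ) : ℝ) = -0.7275 := by
    show (((-291 : ℚ) / 400 : ℚ) : ℝ) = -0.7275
    push_cast; norm_num
  have x2 : (((klCertB1gWinX).mua : ℚ) : ℝ) = -0.6875 := by
    show (((-11 : ℚ) / 16 : ℚ) : ℝ) = -0.6875
    push_cast; norm_num
  have y1 : (((klCertB1gWinY).mub : ℚ) : ℝ) = -0.6875 := by
    show (((-11 : ℚ) / 16 : ℚ) : ℝ) = -0.6875
    push_cast; norm_num
  have y2 : (((klCertB1gWinY).mua : ℚ) : ℝ) = -0.5725 := by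
    show (((-229 : ℚ) / 400 : ℚ) : ℝ) = -0.5725
    push_cast; norm_num
  have z1 : (((klCertB1gWinZ).mub : ℚ) : ℝ) = -0.5725 := by
    show (((-229 : ℚ) / 400 : ℚ) : ℝ) = -0.5725
    push_cast; norm_num
  have z2 : (((klCertB1gWinZ).mua : ℚ) : ℝ) = -0.42749 := by
    show (((-42749 : ℚ) / 100000 : ℚ) : ℝ) = -0.42749
    push_cast; norm_num
  rw [x1, x2] at wX
  rw [y1, y2] at wY
  rw [z1, z2] at wZ
  -- the margins dominate the numeric constant
  have hγX : (14349 / 1048576 : ℝ) ≤ ((klCertB1gWinX.gamma : ℚ) : ℝ) := by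
    have hq : (14349 / 1048576 : ℚ) ≤ klCertB1gWinX.gamma := by decide +kernel
    have h' : ((14349 / 1048576 : ℚ) : ℝ) ≤ ((klCertB1gWinX.gamma : ℚ) : ℝ) := by exact_mod_cast hq
    push_cast at h'
    exact h'
  have hγY : (14349 / 1048576 : ℝ) ≤ ((klCertB1gWinY.gamma : ℚ) : ℝ) := by
    have hq : (14349 / 1048576 : ℚ) ≤ klCertB1gWinY.gamma := by decide +kernel
    have h' : ((14349 / 1048576 : ℚ) : ℝ) ≤ ((klCertB1gWinY.gamma : ℚ) : ℝ) := by exact_mod_cast hq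
    push_cast at h'
    exact h'
  have hγZ : (14349 / 1048576 : ℝ) ≤ ((klCertB1gWinZ.gamma : ℚ) : ℝ) := by
    have hq : (14349 / 1048576 : ℚ) ≤ klCertB1gWinZ.gamma := by decide +kernel
    have h' : ((14349 / 1048576 : ℚ) : ℝ) ≤ ((klCertB1gWinZ.gamma : ℚ) : ℝ) := by exact_mod_cast hq
    push_cast at h'
    exact h'
  have hγABC : (14349 / 1048576 : ℝ) ≤ min (min ((klCertB1gWinA.gamma : ℚ) : ℝ) ((klCertB1gWinB.gamma : ℚ) : ℝ))
      ((klCertB1gWinC.gamma : ℚ) : ℝ) := by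
    have hq : (14349 / 1048576 : ℚ) ≤ klCertB1gWinA.gamma ∧ (14349 / 1048576 : ℚ) ≤ klCertB1gWinB.gamma ∧
        (14349 / 1048576 : ℚ) ≤ klCertB1gWinC.gamma := by
      refine ⟨?_, ?_, ?_⟩ <;> decide +kernel
    obtain ⟨h1, h2, h3⟩ := hq
    have h1' : ((14349 / 1048576 : ℚ) : ℝ) ≤ ((klCertB1gWinA.gamma : ℚ) : ℝ) := by exact_mod_cast h1
    have h2' : ((14349 / 1048576 : ℚ) : ℝ) ≤ ((klCertB1gWinB.gamma : ℚ) : ℝ) := by exact_mod_cast h2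
    have h3' : ((14349 / 1048576 : ℚ) : ℝ) ≤ ((klCertB1gWinC.gamma : ℚ) : ℝ) := by exact_mod_cast h3
    push_cast at h1' h2' h3'
    exact le_min (le_min h1' h2') h3'
  intro μ hμ U hU χ hχ
  have hU2 : 0 ≤ U ^ 2 := sq_nonneg U
  by_cases hx : μ ≤ -0.6875
  · have h := wX μ ⟨hμ.1, hx⟩ U hU χ hχ
    nlinarith
  · by_cases hy : μ ≤ -0.5725
    · have h := wY μ ⟨by linarith, hy⟩ U hU χ hχ
      nlinarith
    · by_cases hz : μ ≤ -0.42749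
      · have h := wZ μ ⟨by linarith, hz⟩ U hU χ hχ
        nlinarith
      · have h := wABC μ ⟨by linarith, hμ.2⟩ U hU χ hχ
        nlinarith

/-! ### The δ-form certificates -/

/-- **R2d certificate half — form (A), δ-form on the FULL window `δ ∈ [0.05, 0.30]`.** Modulo the certified enclosures of the
seven window records: for every `δ ∈ [0.05, 0.30]`, with `μ(δ) = chemicalPotentialOfDensity ε₀ (1 - δ)`: (i) SELECTION — for every
`0 < U < 1` and every `χ ≠ B1g`, `channelInf ε₀ μ(δ) U B1g + (14349/1048576) U² ≤ channelInf ε₀ μ(δ) U χ`; (ii) ATTRACTION — for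
every real `U`, `channelInf ε₀ μ(δ) U B1g ≤ -(1/16) U²`. [cite: RaghuKivelsonScalapino2010, §III Fig. 2] -/
theorem klb1g_formA_r2d_certificate_d005_d030 (hX : klCertB1gWinX.EnclosuresB1g) (hY : klCertB1gWinY.EnclosuresB1g)
    (hZ : klCertB1gWinZ.EnclosuresB1g) (hA : klCertB1gWinA.EnclosuresB1g) (hB : klCertB1gWinB.EnclosuresB1g)
    (hC : klCertB1gWinC.EnclosuresB1g) (hD : klCertB1gWinD.EnclosuresB1g) :
    ∀ δ ∈ Set.Icc (0.05 : ℝ) 0.30,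
      (∀ U ∈ Set.Ioo (0 : ℝ) 1, ∀ χ : D4Irrep, χ ≠ D4Irrep.B1g →
        channelInf (squareDispersion 1 0) (chemicalPotentialOfDensity (squareDispersion 1 0) (1 - δ)) U D4Irrep.B1g +
            (14349 / 1048576 : ℝ) * U ^ 2 ≤
          channelInf (squareDispersion 1 0) (chemicalPotentialOfDensity (squareDispersion 1 0) (1 - δ)) U χ) ∧
      (∀ U : ℝ, channelInf (squareDispersion 1 0) (chemicalPotentialOfDensity (squareDispersion 1 0) (1 - δ)) U
          D4Irrep.B1g ≤ -(1 / 16 : ℝ) * U ^ 2) := by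
  intro δ hδ
  have hμ := muOfDoping_mem_window_d005_d030 δ hδ
  set μ := chemicalPotentialOfDensity (squareDispersion 1 0) (1 - δ) with hμdef
  have hmo : μ ∈ Set.Ioo (-4 : ℝ) 0 := ⟨by linarith [hμ.1], by linarith [hμ.2]⟩
  refine ⟨fun U hU χ hχ => klb1g_window_d005_d030_const hX hY hZ hA hB hC hD μ hμ U hU χ hχ, fun U => ?_⟩
  have hfin : IsFiniteMeasure (fermiCurveMeasure (squareDispersion 1 0) μ) :=
    stub_klFiniteMeasure stub_klGradient stub_klHausdorffFinite μ hmo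
  have hinv := stub_klD4Invariant stub_klGradient μ hmo
  have hhom : channelInf (squareDispersion 1 0) μ U D4Irrep.B1g =
      U ^ 2 * channelInf (squareDispersion 1 0) μ 1 D4Irrep.B1g :=
    klhs_channelInf_sq stub_klKernelHS hmo U D4Irrep.B1g
      (fun ψ hψ => (stub_klMeanZero _ _ hfin hinv D4Irrep.B1g ψ (by decide) hψ).2)
  have h1 : channelInf (squareDispersion 1 0) μ 1 D4Irrep.B1g ≤ -(1 / 16 : ℝ) := by
    by_cases hy : μ ≤ -0.5725
    · exact klb1g_formA_b1g_le_window_d025_d030 hX hY μ ⟨hμ.1, hy⟩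
    · by_cases hz : μ ≤ -0.42749
      · have := klb1g_formA_b1g_le_window_d020_d025 hZ μ ⟨by linarith, hz⟩
        linarith
      · by_cases hd : μ ≤ -0.1775
        · have := klb1g_formA_b1g_le_window hA hB hC μ ⟨by linarith, hd⟩
          linarith
        · have := klb1g_formA_b1g_le_window_d005_d010 hD μ ⟨by linarith, hμ.2⟩
          norm_num at this ⊢
          linarith
  rw [hhom]
  nlinarith [sq_nonneg U]

/-- **R2d certificate half — form (A), δ-form on `δ ∈ [0.10, 0.30]`** (the part of the certified window inside the leaf's
analysis window `[0.10, 0.35]`), modulo the SIX records `X, Y, Z, A, B, C` (no `WinD`): same selection margin `14349/1048576`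
and attraction constant `1/16`. [cite: RaghuKivelsonScalapino2010, §III Fig. 2] -/
theorem klb1g_formA_r2d_certificate_d010_d030 (hX : klCertB1gWinX.EnclosuresB1g) (hY : klCertB1gWinY.EnclosuresB1g)
    (hZ : klCertB1gWinZ.EnclosuresB1g) (hA : klCertB1gWinA.EnclosuresB1g) (hB : klCertB1gWinB.EnclosuresB1g)
    (hC : klCertB1gWinC.EnclosuresB1g) :
    ∀ δ ∈ Set.Icc (0.10 : ℝ) 0.30,
      (∀ U ∈ Set.Ioo (0 : ℝ) 1, ∀ χ : D4Irrep, χ ≠ D4Irrep.B1g →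
        channelInf (squareDispersion 1 0) (chemicalPotentialOfDensity (squareDispersion 1 0) (1 - δ)) U D4Irrep.B1g +
            (14349 / 1048576 : ℝ) * U ^ 2 ≤
          channelInf (squareDispersion 1 0) (chemicalPotentialOfDensity (squareDispersion 1 0) (1 - δ)) U χ) ∧
      (∀ U : ℝ, channelInf (squareDispersion 1 0) (chemicalPotentialOfDensity (squareDispersion 1 0) (1 - δ)) U
          D4Irrep.B1g ≤ -(1 / 16 : ℝ) * U ^ 2) := by
  intro δ hδ
  have hμ := muOfDoping_mem_window_d010_d030 δ hδ
  set μ := chemicalPotentialOfDensity (squareDispersion 1 0) (1 - δ) with hμdef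
  have hmo : μ ∈ Set.Ioo (-4 : ℝ) 0 := ⟨by linarith [hμ.1], by linarith [hμ.2]⟩
  refine ⟨fun U hU χ hχ => klb1g_window_d010_d030_const hX hY hZ hA hB hC μ hμ U hU χ hχ, fun U => ?_⟩
  have hfin : IsFiniteMeasure (fermiCurveMeasure (squareDispersion 1 0) μ) :=
    stub_klFiniteMeasure stub_klGradient stub_klHausdorffFinite μ hmo
  have hinv := stub_klD4Invariant stub_klGradient μ hmo
  have hhom : channelInf (squareDispersion 1 0) μ U D4Irrep.B1g =
      U ^ 2 * channelInf (squareDispersion 1 0) μ 1 D4Irrep.B1g :=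
    klhs_channelInf_sq stub_klKernelHS hmo U D4Irrep.B1g
      (fun ψ hψ => (stub_klMeanZero _ _ hfin hinv D4Irrep.B1g ψ (by decide) hψ).2)
  have h1 : channelInf (squareDispersion 1 0) μ 1 D4Irrep.B1g ≤ -(1 / 16 : ℝ) := by
    by_cases hy : μ ≤ -0.5725
    · exact klb1g_formA_b1g_le_window_d025_d030 hX hY μ ⟨hμ.1, hy⟩
    · by_cases hz : μ ≤ -0.42749
      · have := klb1g_formA_b1g_le_window_d020_d025 hZ μ ⟨by linarith, hz⟩
        linarith
      · have := klb1g_formA_b1g_le_window hA hB hC μ ⟨by linarith, hμ.2⟩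
        linarith
  rw [hhom]
  nlinarith [sq_nonneg U]

/-- **Positivity of the Kohn–Luttinger coefficient on the full window, form (A)**: for every `δ ∈ [0.05, 0.30]`,
`1/16 ≤ -channelInf ε₀ μ(δ) 1 B1g`. [cite: RaghuKivelsonScalapino2010, §III Fig. 2] -/
theorem klb1g_formA_klCoefficient_ge_d005_d030 (hX : klCertB1gWinX.EnclosuresB1g) (hY : klCertB1gWinY.EnclosuresB1g)
    (hZ : klCertB1gWinZ.EnclosuresB1g) (hA : klCertB1gWinA.EnclosuresB1g) (hB : klCertB1gWinB.EnclosuresB1g)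
    (hC : klCertB1gWinC.EnclosuresB1g) (hD : klCertB1gWinD.EnclosuresB1g) :
    ∀ δ ∈ Set.Icc (0.05 : ℝ) 0.30,
      (1 / 16 : ℝ) ≤ -channelInf (squareDispersion 1 0) (chemicalPotentialOfDensity (squareDispersion 1 0) (1 - δ)) 1
        D4Irrep.B1g := by
  intro δ hδ
  have h := (klb1g_formA_r2d_certificate_d005_d030 hX hY hZ hA hB hC hD δ hδ).2 1
  norm_num at h ⊢
  linarith

/-- **Positivity of the Kohn–Luttinger coefficient on `δ ∈ [0.10, 0.30]`, form (A)** (six records): for every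
`δ ∈ [0.10, 0.30]`, `1/16 ≤ -channelInf ε₀ μ(δ) 1 B1g`. [cite: RaghuKivelsonScalapino2010, §III Fig. 2] -/
theorem klb1g_formA_klCoefficient_ge_d010_d030 (hX : klCertB1gWinX.EnclosuresB1g) (hY : klCertB1gWinY.EnclosuresB1g)
    (hZ : klCertB1gWinZ.EnclosuresB1g) (hA : klCertB1gWinA.EnclosuresB1g) (hB : klCertB1gWinB.EnclosuresB1g)
    (hC : klCertB1gWinC.EnclosuresB1g) :
    ∀ δ ∈ Set.Icc (0.10 : ℝ) 0.30,
      (1 / 16 : ℝ) ≤ -channelInf (squareDispersion 1 0) (chemicalPotentialOfDensity (squareDispersion 1 0) (1 - δ)) 1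
        D4Irrep.B1g := by
  intro δ hδ
  have h := (klb1g_formA_r2d_certificate_d010_d030 hX hY hZ hA hB hC δ hδ).2 1
  norm_num at h ⊢
  linarith

end Summit.HubbardSuperconductivity.HubbardSuperconductivity.Theorems

end
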